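import Summits.Ventures.PercRepro.SixFourPLXbar

/-!
# PercRepro — C-025 at `(6,4)`, §22.12.1: the normalisation of a plane-line set and its line `ℓ′` (p3, gen 9)

mine-2's `MINE2-RLS.md` §22.12.1 (i)–(ii): a NON-generic rank-`4` set `G ⊆ E` of a simple matroid has a plane `P₀`
whose trace `ρ = P₀ ∩ G` has rank `3` while the rest `L = G ∖ P₀` has rank `≤ 2` (`exists_plane_trace_three`: from
`¬ Generic` take a plane `P` with `ρ(G ∖ P) ≤ 2`; if its trace has rank `≤ 2`, `G` is the union of two skew
rank-`2` sets and for any `x ∈ G ∖ P` the plane `cl((P ∩ G) ∪ {x})` has trace exactly `(P ∩ G) ∪ {x}`).  Such a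
choice is packaged as `PLData M G`; then, with `g ≥ 10` and plane traces `≤ 7`, `L` has `n = g − p ≥ 3` points,
rank exactly `2`, its closure is a line `ℓ` of `M` (`ellF`) whose trace `ℓ′ = ℓ ∩ G ⊇ L`, and `ℓ` meets `ρ` in at most
one point (`card_ellF_inter_le_one`: the flat `ℓ ∩ P₀` has rank `≤ 1`, else `L ⊆ P₀`) — the skew / meeting
dichotomy of 22.12.1.
-/

namespace PercRepro.SixFour

open Finset ThmH

variable {α : Type*} [DecidableEq α] {M : Matroid α} [M.Finite] {G : Finset α}

omit [DecidableEq α] in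
/-- A rank `< 3` in `ℕ∞` is `≤ 2`. -/
theorem eRk_le_two_of_lt_three {X : Finset α} (h : M.eRk (X : Set α) < 3) : M.eRk (X : Set α) ≤ 2 := by
  obtain ⟨k, hk, -⟩ := eRk_eq_nat M X
  rw [hk] at h ⊢
  have : k < 3 := by exact_mod_cast h
  exact_mod_cast (show k ≤ 2 by omega)

/-- The trace of a plane has rank `≤ 3`. -/
theorem eRk_inter_plane_le_three {P : Finset α} (hP : P ∈ planes M) (X : Finset α) :
    M.eRk ((P ∩ X : Finset α) : Set α) ≤ 3 := by
  rw [← (mem_planes.1 hP).2.2]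
  exact M.eRk_mono (Finset.coe_subset.2 Finset.inter_subset_left)

/-- Two distinct points of a set `L` of rank `≤ 2` of a simple matroid span `cl(L)`. -/
theorem closure_pair_eq_of_eRk_le_two (hs : Simple M) {L : Finset α} (hL : L ⊆ gr M)
    (hr : M.eRk (L : Set α) ≤ 2) {x y : α} (hx : x ∈ L) (hy : y ∈ L) (hxy : x ≠ y) :
    M.closure (({x, y} : Finset α) : Set α) = M.closure (L : Set α) := by
  have hsub : ({x, y} : Finset α) ⊆ L := by
    intro z hz
    rw [Finset.mem_insert, Finset.mem_singleton] at hz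
    rcases hz with rfl | rfl
    · exact hx
    · exact hy
  have h2 : (2 : ℕ∞) ≤ M.eRk (({x, y} : Finset α) : Set α) :=
    two_le_eRk_of_two_mem hs (hsub.trans hL) (Finset.mem_insert_self _ _)
      (Finset.mem_insert_of_mem (Finset.mem_singleton_self _)) hxy
  have hsub' : (({x, y} : Finset α) : Set α) ⊆ M.closure (L : Set α) :=
    (Finset.coe_subset.2 hsub).trans (M.subset_closure _ (by rw [← coe_gr]; exact_mod_cast hL))
  exact closure_eq_of_subset_flat (M.isFlat_closure _) hsub' (Finset.finite_toSet _)
    (by rw [M.eRk_closure_eq]; exact hr.trans h2)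

/-- **Normalisation (22.12.1 (i))**: a non-generic rank-`4` set has a plane whose trace has rank `3` and whose
complement in `G` has rank `≤ 2`. -/
theorem exists_plane_trace_three (hs : Simple M) (hG : G ⊆ gr M) (hr : M.eRk (G : Set α) = 4)
    (hng : ¬ Generic M G) :
    ∃ P ∈ planes M, M.eRk ((P ∩ G : Finset α) : Set α) = 3 ∧ M.eRk ((G \ P : Finset α) : Set α) ≤ 2 := by
  unfold Generic at hng
  push Not at hng
  obtain ⟨P, hP, hPlt⟩ := hng
  have hP2 : M.eRk ((G \ P : Finset α) : Set α) ≤ 2 := eRk_le_two_of_lt_three hPlt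
  by_cases h3 : M.eRk ((P ∩ G : Finset α) : Set α) = 3
  · exact ⟨P, hP, h3, hP2⟩
  have hPflat := (mem_planes.1 hP).2.1
  have hPG : P ⊆ gr M := (mem_planes.1 hP).1
  -- the trace has rank exactly `2` (`4 = ρ(G) ≤ ρ(P ∩ G) + ρ(G ∖ P) ≤ ρ(P ∩ G) + 2`)
  have hsplit : G = (P ∩ G) ∪ (G \ P) := by
    ext y
    rw [Finset.mem_union, Finset.mem_inter, Finset.mem_sdiff]
    constructor
    · intro hy
      by_cases hyP : y ∈ P
      · exact Or.inl ⟨hyP, hy⟩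
      · exact Or.inr ⟨hy, hyP⟩
    · rintro (⟨-, hy⟩ | ⟨hy, -⟩) <;> exact hy
  have hle3 := eRk_inter_plane_le_three hP G
  obtain ⟨k, hk, -⟩ := eRk_eq_nat M (P ∩ G)
  have hk2 : k = 2 := by
    have h := M.eRk_union_le_eRk_add_eRk ((P ∩ G : Finset α) : Set α) ((G \ P : Finset α) : Set α)
    rw [← Finset.coe_union, ← hsplit, hr, hk] at h
    have h' : (4 : ℕ∞) ≤ (k : ℕ∞) + 2 := h.trans (add_le_add (le_refl _) hP2)
    have h'' : ((4 : ℕ) : ℕ∞) ≤ ((k + 2 : ℕ) : ℕ∞) := by push_cast; exact h'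
    have hk3 : k ≤ 3 := by rw [hk] at hle3; exact_mod_cast hle3
    have hk3' : k ≠ 3 := by rw [hk] at h3; exact_mod_cast h3
    have := (Nat.cast_le (α := ℕ∞)).1 h''
    omega
  -- a point `x ∈ G ∖ P`
  have hne : (G \ P).Nonempty := by
    by_contra h
    rw [Finset.not_nonempty_iff_eq_empty, Finset.sdiff_eq_empty_iff_subset] at h
    exact not_subset_plane hr hP h
  obtain ⟨x, hx⟩ := hne
  rw [Finset.mem_sdiff] at hx
  have hxE : x ∈ M.E := by rw [← coe_gr]; exact_mod_cast hG hx.1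
  have hxcl : x ∉ M.closure ((P ∩ G : Finset α) : Set α) := by
    intro h
    have : M.closure ((P ∩ G : Finset α) : Set α) ⊆ (P : Set α) := by
      calc M.closure ((P ∩ G : Finset α) : Set α) ⊆ M.closure (P : Set α) :=
            M.closure_subset_closure (Finset.coe_subset.2 Finset.inter_subset_left)
        _ = (P : Set α) := hPflat.closure
    exact hx.2 (this h)
  -- `Z = (P ∩ G) ∪ {x}` has rank `3`
  have hZ3 : M.eRk ((insert x (P ∩ G) : Finset α) : Set α) = 3 := by
    rw [Finset.coe_insert, Matroid.eRk_insert_eq_add_one ⟨hxE, hxcl⟩, hk, hk2]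
    rfl
  have hZG : insert x (P ∩ G) ⊆ G := Finset.insert_subset hx.1 Finset.inter_subset_right
  obtain ⟨hP₀, hZP₀⟩ := clF_mem_planes (hZG.trans hG) hZ3
  refine ⟨clF M (insert x (P ∩ G)), hP₀, ?_, ?_⟩
  · -- the trace of the new plane is exactly `Z`
    have htrace : clF M (insert x (P ∩ G)) ∩ G = insert x (P ∩ G) := by
      apply Finset.Subset.antisymm
      · intro y hy
        rw [Finset.mem_inter] at hy
        by_contra hyZ
        have hyP : y ∉ P := by
          intro hyP
          exact hyZ (Finset.mem_insert_of_mem (Finset.mem_inter.2 ⟨hyP, hy.2⟩))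
        have hyx : x ≠ y := by
          rintro rfl
          exact hyZ (Finset.mem_insert_self _ _)
        have hyL : y ∈ G \ P := Finset.mem_sdiff.2 ⟨hy.2, hyP⟩
        have hxL : x ∈ G \ P := Finset.mem_sdiff.2 hx
        -- `cl{x, y} = cl(G ∖ P)`, and `{x, y} ⊆ P₀`, so `G ∖ P ⊆ P₀`
        have hpair := closure_pair_eq_of_eRk_le_two hs (Finset.sdiff_subset.trans hG) hP2 hxL hyL hyx
        have hsubP₀ : (({x, y} : Finset α) : Set α) ⊆ M.closure ((insert x (P ∩ G) : Finset α) : Set α) := by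
          intro z hz
          rw [Finset.mem_coe, Finset.mem_insert, Finset.mem_singleton] at hz
          rcases hz with rfl | rfl
          · rw [← coe_clF]; exact_mod_cast hZP₀ (Finset.mem_insert_self _ _)
          · rw [← coe_clF]; exact_mod_cast hy.1
        have hLsub : ((G \ P : Finset α) : Set α) ⊆ M.closure ((insert x (P ∩ G) : Finset α) : Set α) := by
          calc ((G \ P : Finset α) : Set α) ⊆ M.closure ((G \ P : Finset α) : Set α) :=
                M.subset_closure _ (by rw [← coe_gr]; exact_mod_cast Finset.sdiff_subset.trans hG)
            _ = M.closure (({x, y} : Finset α) : Set α) := hpair.symm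
            _ ⊆ M.closure (M.closure ((insert x (P ∩ G) : Finset α) : Set α)) :=
                M.closure_subset_closure hsubP₀
            _ = M.closure ((insert x (P ∩ G) : Finset α) : Set α) := M.closure_closure _
        apply not_subset_plane hr hP₀
        intro z hz
        rw [← Finset.mem_coe, coe_clF]
        by_cases hzP : z ∈ P
        · exact M.subset_closure _ (by rw [← coe_gr]; exact_mod_cast hZG.trans hG)
            (Finset.mem_coe.2 (Finset.mem_insert_of_mem (Finset.mem_inter.2 ⟨hzP, hz⟩)))
        · exact hLsub (Finset.mem_coe.2 (Finset.mem_sdiff.2 ⟨hz, hzP⟩))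
      · exact Finset.subset_inter hZP₀ hZG
    rw [htrace]
    exact hZ3
  · -- `G ∖ P₀ ⊆ G ∖ P`
    have hsub : G \ clF M (insert x (P ∩ G)) ⊆ G \ P := by
      intro y hy
      rw [Finset.mem_sdiff] at hy ⊢
      refine ⟨hy.1, fun hyP => hy.2 ?_⟩
      exact hZP₀ (Finset.mem_insert_of_mem (Finset.mem_inter.2 ⟨hyP, hy.1⟩))
    exact (M.eRk_mono (Finset.coe_subset.2 hsub)).trans hP2

/-! ## The normalised data -/

/-- A plane-line NORMALISATION of `G`: a plane `P₀` whose trace has rank `3` and whose complement in `G` has rank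
`≤ 2` (22.12.1 (i)). -/
structure PLData (M : Matroid α) [M.Finite] (G : Finset α) where
  /-- the distinguished plane -/
  P₀ : Finset α
  /-- it is a plane of `M` -/
  plane : P₀ ∈ planes M
  /-- its trace `ρ = P₀ ∩ G` has rank `3` -/
  rank_trace : M.eRk ((P₀ ∩ G : Finset α) : Set α) = 3
  /-- the rest `L = G ∖ P₀` has rank `≤ 2` -/
  rank_rest : M.eRk ((G \ P₀ : Finset α) : Set α) ≤ 2

/-- Every non-generic rank-`4` set of a simple matroid has a normalisation. -/
theorem exists_PLData (hs : Simple M) (hG : G ⊆ gr M) (hr : M.eRk (G : Set α) = 4) (hng : ¬ Generic M G) :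
    ∃ _ : PLData M G, True := by
  obtain ⟨P, hP, h3, h2⟩ := exists_plane_trace_three hs hG hr hng
  exact ⟨⟨P, hP, h3, h2⟩, trivial⟩

namespace PLData

variable (D : PLData M G)

/-- `ρ = P₀ ∩ G`, the distinguished plane trace. -/
def ρ : Finset α := D.P₀ ∩ G

/-- `L = G ∖ P₀`, the collinear rest. -/
def L : Finset α := G \ D.P₀

/-- `ℓ = cl(L)`, the line through the rest. -/
noncomputable def ellF : Finset α := clF M D.L

/-- `ρ ⊆ G`. -/
theorem ρ_subset : D.ρ ⊆ G := Finset.inter_subset_right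

/-- `L ⊆ G`. -/
theorem L_subset : D.L ⊆ G := Finset.sdiff_subset

/-- `g = p + n`. -/
theorem card_ρ_add_card_L : D.ρ.card + D.L.card = G.card := by
  unfold ρ L
  rw [Finset.inter_comm, Finset.card_inter_add_card_sdiff]

/-- With `g ≥ 10` and the plane trace `≤ 7`, the rest has `n ≥ 3` points. -/
theorem three_le_card_L (hpl : (D.P₀ ∩ G).card ≤ 7) (hg : 10 ≤ G.card) : 3 ≤ D.L.card := by
  have := D.card_ρ_add_card_L
  unfold ρ at this
  omega

/-- The rest has rank exactly `2` (simple; at least `2` points). -/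
theorem eRk_L_eq_two (hs : Simple M) (hG : G ⊆ gr M) (h2 : 2 ≤ D.L.card) : M.eRk ((D.L : Finset α) : Set α) = 2 := by
  obtain ⟨a, ha, b, hb, hab⟩ := Finset.one_lt_card.1 (by omega : 1 < D.L.card)
  exact le_antisymm D.rank_rest (two_le_eRk_of_two_mem hs (D.L_subset.trans hG) ha hb hab)

/-- `ℓ = cl(L)` is a line of `M` containing `L`. -/
theorem ellF_mem_lines (hs : Simple M) (hG : G ⊆ gr M) (h2 : 2 ≤ D.L.card) :
    D.ellF ∈ lines M ∧ D.L ⊆ D.ellF :=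
  clF_mem_lines (D.L_subset.trans hG) (D.eRk_L_eq_two hs hG h2)

/-- `L ⊆ ℓ`. -/
theorem L_subset_ellF (hs : Simple M) (hG : G ⊆ gr M) (h2 : 2 ≤ D.L.card) : D.L ⊆ D.ellF :=
  (D.ellF_mem_lines hs hG h2).2

/-- The line `ℓ` is not contained in `P₀`. -/
theorem not_ellF_subset_P₀ (hs : Simple M) (hG : G ⊆ gr M) (h2 : 2 ≤ D.L.card) : ¬ D.ellF ⊆ D.P₀ := by
  intro h
  obtain ⟨a, ha⟩ := Finset.card_pos.1 (by omega : 0 < D.L.card)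
  have haP : a ∈ D.P₀ := h (D.L_subset_ellF hs hG h2 ha)
  unfold L at ha
  exact (Finset.mem_sdiff.1 ha).2 haP

/-- **The meeting point is unique (22.12.1 (ii))**: `ℓ ∩ P₀` has at most one point — its rank is `≤ 1`, since
rank `2` would force `ℓ = cl(ℓ ∩ P₀) ⊆ P₀`. -/
theorem card_ellF_inter_le_one (hs : Simple M) (hG : G ⊆ gr M) (h2 : 2 ≤ D.L.card) :
    (D.ellF ∩ D.P₀).card ≤ 1 := by
  have hℓ := (D.ellF_mem_lines hs hG h2).1
  have hℓg : D.ellF ⊆ gr M := (mem_lines.1 hℓ).1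
  by_contra hlt
  push Not at hlt
  obtain ⟨a, ha, b, hb, hab⟩ := Finset.one_lt_card.1 hlt
  have h2' : M.eRk ((D.ellF ∩ D.P₀ : Finset α) : Set α) = 2 := by
    apply le_antisymm
    · rw [← (mem_lines.1 hℓ).2.2]
      exact M.eRk_mono (Finset.coe_subset.2 Finset.inter_subset_left)
    · exact two_le_eRk_of_two_mem hs (Finset.inter_subset_left.trans hℓg) ha hb hab
  have hcl := closure_eq_of_subset_line hℓ Finset.inter_subset_left h2'
  apply D.not_ellF_subset_P₀ hs hG h2
  rw [← Finset.coe_subset, ← hcl]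
  calc M.closure ((D.ellF ∩ D.P₀ : Finset α) : Set α) ⊆ M.closure (D.P₀ : Set α) :=
        M.closure_subset_closure (Finset.coe_subset.2 Finset.inter_subset_right)
    _ = (D.P₀ : Set α) := (mem_planes.1 D.plane).2.1.closure

end PLData

end PercRepro.SixFour
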